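import Summits.BirchSwinnertonDyer.BirchSwinnertonDyer.Theorems.PrintCFramBottomClassIndexLawFiveLeSelmerCountLowerBoundPRank
import Summits.BirchSwinnertonDyer.BirchSwinnertonDyer.Theorems.PrintCFramBottomClassIndexLawFiveLeHerbrandCountPRankEvenRadical
import HarnessLib

/-!
# Route `PrintCFram`, crux C2 `BottomClassIndexLawFiveLe` (stmt-BirchSwinnertonDyer-20372), line
# `eisenstein-resource-bdp-line` (registry v23/v24, stubs B1-level / B1-sha): **LEOPOLDT'S REFLECTION AS AN EQUALITY FOR THE
# RELAXED GROUP OF AN ODD CHARACTER** — for a `Γ_ℚ`-line `A = 𝔽_p(χ̄)` with `χ̄` ODD and `ω χ̄⁻¹` non-trivial on the decomposition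
# groups above `p`, and its abelian CM reflection field `K' ∋ ζ_p` (`p ∤ [K':ℚ]`):
# **`#H¹_{S_p-rel}(ℚ, A) = p · #(e_{ω∘ψ̄}(ℤ_p ⊗ Cl(𝓞 K')))[p]`**, i.e. `dim_𝔽_p R_rel(χ̄) = 1 + rank_p e_{ωχ̄⁻¹}(Cl K')`
# (cell `bsd-print-cfram`, width seat `bsd-line-cfram-p1-w7` g5; helper `--supports` 20372; 0 defs, 0 facts, 0 sorry)

HONEST FRAMING. Nothing about BSD is proved here; no summit statement is proved by this seat; no stub of the registered skeleton is
closed. The two halves were in the tree separately: the UPPER bound `#R_rel(A) ≤ p · #(e_{ω∘ψ̄})[p]` is w4 g10's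
`HerbrandCountPRank.natCard_h1Unramified_le_prime_mul_chiTorsion_of_odd_character` (p684629: the even-radical Kummer count, Herbrand's
unit theorem, w2 g9's bridge); the LOWER bound `p^{r+1} ≤ #R_rel(A)` for `p^r ≤ #(e_{ω∘ψ̄})[p]` is this seat's family supply
(`KummerRadical.exists_independent_kummer_characters_of_odd_character_of_pow_le` + `SelmerCount.pow_card_le_natCard_h1Unramified_of_characters`,
p688925 / `…SelmerCountLowerBoundPRank`). Since the `p`-torsion of the component is an `𝔽_p`-vector space, `#(e_{ω∘ψ̄})[p] = p^s` exactly,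
and the two bounds meet. This is the «Greenberg–Wiles count `u_rel(ψ) = 1 + u(θ_e)`» that w2 g10's `…SelmerCountLowerBound` docstring
named as the missing input of B1-sha, now a kernel theorem in class-group `p`-rank currency (for the SAME field `K'` on both sides).

* §1 `exists_natCard_torsion_classGroupChiComponent_eq_pow` — `#{y ∈ e_ψ(ℤ_p ⊗ Cl K) | p • y = 0} = p^s` for some `s`.
* §2 **`natCard_h1Unramified_eq_prime_mul_natCard_torsion_of_odd_character`** — hypotheses of p684629's
  `natCard_h1Unramified_le_prime_mul_chiTorsion_of_odd_character` VERBATIM ⊢ EQUALITY.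
* §3 `natCard_torsion_classGroupChiComponent_eq_one_iff` (`#C[p] = 1 ↔ classGroupChiCard = 1`),
  `prime_le_natCard_torsion_classGroupChiComponent_iff`, and **`natCard_h1Unramified_eq_prime_iff_and_sq_le_iff_of_odd_character`**:
  EVEN-REGULAR(K') ⟺ `#R_rel = p`, EVEN-IRREGULAR(K') ⟺ `p² ≤ #R_rel` (the census dichotomy of p685598 §3 / p683684 as an `iff`).

THEOREMS ONLY; no definition, no named fact, no `sorry`. References: [Washington1997] §10.2 (Thm. 10.9, Leopoldt's Spiegelungssatz);
[Gras2003] Ch. II §5.4; [SerreGaloisCohomology1997] I.§2.6 (b); seat notes w2g9/w2g10 §5, w4g10, w7g4, w7g5.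
-/

set_option autoImplicit false
-- `…BirchSwinnertonDyer.BirchSwinnertonDyer.Theorems…` is the problem's mandated namespace (D-0017).
set_option linter.dupNamespace false

noncomputable section

open scoped Classical

/-! ## §1 The `p`-torsion of a class-group component has `p`-power order -/

namespace Summit.BirchSwinnertonDyer.BirchSwinnertonDyer.Theorems.PrintCFram.KummerRadical

open Literature.NumberTheory.NumberFields Literature.NumberTheory.GaloisRepresentations
open Literature.Geometry.Kaehler.FiniteAddGroup
open NumberField IsDedekindDomain Field Module
open scoped TensorProduct

section Torsion

variable {K : Type} [Field K] [NumberField K] {p : ℕ} [hp : Fact p.Prime]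

/-- The `p`-torsion `{y ∈ e_ψ(ℤ_p ⊗ Cl(𝓞 K)) | p • y = 0}` of a class-group component is an `𝔽_p`-vector space, so it has exactly
`p^s` elements for some `s` (its `p`-rank). [cite: Washington1997, §6.3 and §10.2] -/
theorem exists_natCard_torsion_classGroupChiComponent_eq_pow (ψ : (K ≃ₐ[ℚ] K) → ℤ_[p]) :
    ∃ s : ℕ, Nat.card {y : ↥(classGroupChiComponent ℚ K p ψ) // p • y = 0} = p ^ s := by
  haveI : NeZero p := ⟨hp.out.ne_zero⟩
  set C := classGroupChiComponent ℚ K p ψ with hC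
  set T : AddSubgroup ↥C := AddSubgroup.torsionBy (↥C) p with hT
  letI : Module (ZMod p) T := AddSubgroup.torsionBy.zmodModule
  haveI : Module.Finite (ZMod p) T := Module.Finite.of_finite
  refine ⟨Module.finrank (ZMod p) T, ?_⟩
  rw [← Nat.card_congr (Equiv.subtypeEquivRight (fun y : ↥C => (AddSubgroup.torsionBy.nsmul_iff (x := y) (n := p)))),
    Module.natCard_eq_pow_finrank (K := ZMod p), Nat.card_zmod]

end Torsion

end Summit.BirchSwinnertonDyer.BirchSwinnertonDyer.Theorems.PrintCFram.KummerRadical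

/-! ## §2 Leopoldt's reflection as an equality for the relaxed group of an odd character -/

namespace Summit.BirchSwinnertonDyer.BirchSwinnertonDyer.Theorems.PrintCFram.SelmerCount

open NumberField IsDedekindDomain Field WeierstrassCurve
open Literature.NumberTheory.EllipticCurves Literature.NumberTheory.GaloisRepresentations
  Literature.NumberTheory.EllipticCurves.GreenbergSelmer Literature.NumberTheory.EllipticCurves.Rank1Residual
  Literature.NumberTheory.NumberFields Literature.NumberTheory.EllipticCurves.Kato2004
open Summit.BirchSwinnertonDyer.Rank1Residual.X2.ResidualDevissageModules

section Equality

variable {p : ℕ} [hp : Fact p.Prime]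
variable {A : Type} [AddCommGroup A] [DistribMulAction (absoluteGaloisGroup ℚ) A] [TopologicalSpace A] [DiscreteTopology A]

/-- **LEOPOLDT'S REFLECTION AS AN EQUALITY: `#H¹_{S_p-rel}(ℚ, A) = p · #(e_{ω∘ψ̄}(ℤ_p ⊗ Cl K'))[p]`.** `A` a discrete `Γ_ℚ`-line of
order `p` with continuous orbit maps and non-trivial action, character `θ : Γ_ℚ →* 𝔽_pˣ` (`θ g = 1 ↔ g` acts trivially), ODD
(`θ c = −1`), with radical `χ̄_p θ⁻¹` non-trivial on the decomposition group of every prime above `p` (`H`) and somewhere (`hrad`);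
`K'` an abelian CM field with `ζ_p ∈ K'`, `p ∤ [K':ℚ]`, `θ(res Γ_{K'}) = 1`, `hk` (a prime-to-`p` power of `ker θ` restricts from `K'`),
`hcc` (`c̄` is complex conjugation), and the descents `χ̄` of `θ` and `ψ̄` of `χ̄_p θ⁻¹` to `Gal(K'/ℚ)` — EXACTLY the hypotheses of w4 g10's
upper bound `HerbrandCountPRank.natCard_h1Unramified_le_prime_mul_chiTorsion_of_odd_character`. THEN the relaxed residual group of `A`
(unramified outside `S_p`, no condition at `p`) has EXACTLY `p · #{y ∈ e_{ω∘ψ̄}(ℤ_p ⊗ Cl(𝓞 K')) | p • y = 0}` elements: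
`dim_𝔽_p R_rel(χ̄) = 1 + rank_p e_{ωχ̄⁻¹}(ℤ_p ⊗ Cl K')` — one dimension from Herbrand's Minkowski unit, `rank_p` from the class radicals,
and nothing else (no `p`-unit radicals, by `H`). Upper: p684629; lower: `#(e)[p] = p^s` (§1), `s + 1` independent admissible Kummer
characters (`KummerRadical.exists_independent_kummer_characters_of_odd_character_of_pow_le`), family supply count
(`pow_card_le_natCard_h1Unramified_of_characters`). [cite: Washington1997, §10.2 (Thm. 10.9)] [cite: Gras2003, Ch. II §5.4]
[cite: SerreGaloisCohomology1997, I.§2.6 (b)] -/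
theorem natCard_h1Unramified_eq_prime_mul_natCard_torsion_of_odd_character
    (hcard : Nat.card A = p)
    (hcont : ∀ a : A, Continuous fun g : absoluteGaloisGroup ℚ ↦ g • a)
    (hnt : ∃ (g : absoluteGaloisGroup ℚ) (a : A), g • a ≠ a)
    (θ : absoluteGaloisGroup ℚ →* (ZMod p)ˣ)
    (hθ : ∀ (g : absoluteGaloisGroup ℚ) (a : A), g • a = (((θ g : ZMod p).val : ℕ) : ℤ) • a)
    (hker : ∀ g : absoluteGaloisGroup ℚ, θ g = 1 ↔ ∀ a : A, g • a = a)
    {c : absoluteGaloisGroup ℚ} (hθc : θ c = -1)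
    (H : ∀ (ℓ : HeightOneSpectrum (𝓞 ℚ)), ((p : ℕ) : 𝓞 ℚ) ∈ ℓ.asIdeal → ∀ 𝔓 ∈ ℓ.primesAbove,
      ∃ g ∈ 𝔓.decompositionSubgroup (absoluteGaloisGroup ℚ), θ g ≠ modNCyclotomicCharacter ℚ p g)
    (hrad : ∃ g : absoluteGaloisGroup ℚ, θ g ≠ modNCyclotomicCharacter ℚ p g)
    {K' : Type} [Field K'] [NumberField K'] [IsCMField K'] [IsAbelianGalois ℚ K'] {ζ : K'} (hζ : IsPrimitiveRoot ζ p)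
    (hpK : ¬ p ∣ Module.finrank ℚ K')
    (hrK : ∀ σ : absoluteGaloisGroup K', θ (absGaloisRestrict ℚ K' σ) = 1)
    (hk : ∃ k : ℕ, ¬ p ∣ k ∧ ∀ n : absoluteGaloisGroup ℚ, θ n = 1 → n ^ k ∈ (absGaloisRestrict ℚ K').range)
    (hcc : absGaloisQuot ℚ K' c = (IsCMField.complexConj K').restrictScalars ℚ)
    (χb ψb : (K' ≃ₐ[ℚ] K') →* (ZMod p)ˣ) (hχb : ∀ γ : absoluteGaloisGroup ℚ, χb (absGaloisQuot ℚ K' γ) = θ γ)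
    (hψb : ∀ γ : absoluteGaloisGroup ℚ, ψb (absGaloisQuot ℚ K' γ) = modNCyclotomicCharacter ℚ p γ * (θ γ)⁻¹) :
    Nat.card ↥(h1Unramified A {v' : HeightOneSpectrum (𝓞 ℚ) | ((p : ℕ) : 𝓞 ℚ) ∈ v'.asIdeal}) =
      p * Nat.card {y : ↥(classGroupChiComponent ℚ K' p
        (fun g => (((teichmullerChar p).comp ψb g : ℤ_[p]ˣ) : ℤ_[p]))) // p • y = 0} := by
  haveI hpne : NeZero p := ⟨hp.out.ne_zero⟩
  haveI : IsGalois ℚ K' := IsAbelianGalois.toIsGalois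
  have hp0 : ((p : ℕ) : ℤ) ≠ 0 := by exact_mod_cast hp.out.ne_zero
  -- the upper bound (w4 g10)
  have hup := HerbrandCountPRank.natCard_h1Unramified_le_prime_mul_chiTorsion_of_odd_character hcard hcont hnt θ hθ hker hθc H
    hrad hζ hpK hrK hk hcc χb ψb hχb hψb
  -- `#(e)[p] = p^s`
  obtain ⟨s, hs⟩ := KummerRadical.exists_natCard_torsion_classGroupChiComponent_eq_pow (K := K')
    (fun g => (((teichmullerChar p).comp ψb g : ℤ_[p]ˣ) : ℤ_[p]))
  -- cyclotomic exponents, parity, the radical `ψ̄ = ā χ̄⁻¹ ≠ 1` (as in p684629)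
  have hsurj := absGaloisQuot_surjective ℚ K'
  set ā : (K' ≃ₐ[ℚ] K') →* (ZMod p)ˣ := hζ.autToPow ℚ with hādef
  set a : (K' ≃ₐ[ℚ] K') → ℕ := fun σ => ((ā σ : (ZMod p)ˣ) : ZMod p).val with hadef
  have ha : ∀ σ : K' ≃ₐ[ℚ] K', σ ζ = ζ ^ a σ := fun σ => (hζ.autToPow_spec ℚ σ).symm
  have hoddχ : χb ((IsCMField.complexConj K').restrictScalars ℚ) = -1 := by rw [← hcc, hχb, hθc]
  have hψeq : ψb = ā * χb⁻¹ := by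
    ext σ
    obtain ⟨γ, rfl⟩ := hsurj σ
    rw [MonoidHom.mul_apply, MonoidHom.inv_apply, hψb, hχb, hādef, HerbrandSelmerToHom.autToPow_absGaloisQuot_eq hζ γ]
  have hψb' : ∀ σ : K' ≃ₐ[ℚ] K', ((ψb σ : (ZMod p)ˣ) : ZMod p) =
      (a σ : ZMod p) * (((χb σ)⁻¹ : (ZMod p)ˣ) : ZMod p) := fun σ => by
    rw [hψeq, MonoidHom.mul_apply, MonoidHom.inv_apply, Units.val_mul, hadef, ZMod.natCast_zmod_val]
  have hψb1 : ψb ≠ 1 := by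
    obtain ⟨γ, hγ⟩ := hrad
    intro h1
    apply hγ
    have h := hψb γ
    rw [h1, MonoidHom.one_apply] at h
    exact (eq_mul_inv_iff_mul_eq.mp h).symm.trans (one_mul _) |>.symm
  -- the lower bound: `s + 1` independent admissible characters
  obtain ⟨κ, hκ, hind⟩ :=
    KummerRadical.exists_independent_kummer_characters_of_odd_character_of_pow_le hpK hζ a ha χb hoddχ ψb hψb1 hψb' hs.ge
  have hSpfin : {v' : HeightOneSpectrum (𝓞 ℚ) | ((p : ℕ) : 𝓞 ℚ) ∈ v'.asIdeal}.Finite := by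
    convert finite_setOf_intCast_mem_asIdeal (K := ℚ) hp0 using 1
    ext v'
    simp only [Set.mem_setOf_eq, Int.cast_natCast]
  have hlow := pow_card_le_natCard_h1Unramified_of_characters hcard hcont θ hθ hpK hrK hSpfin κ (fun j => (hκ j).1)
    (fun j u hu => (hκ j).2.1 u (natCast_not_mem_of_under_not_mem hu)) (fun j γ σ => by rw [(hκ j).2.2 γ σ, hχb]) hind
  rw [Fintype.card_option, Fintype.card_fin, pow_succ'] at hlow
  rw [hs] at hup ⊢
  exact le_antisymm hup hlow

end Equality

/-! ## §3 The census currency `classGroupChiCard`: EVEN-REGULAR ⟺ `#R_rel = p`, EVEN-IRREGULAR ⟺ `#R_rel ≥ p²` -/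

section Currency

open scoped TensorProduct

variable {K : Type} [Field K] [NumberField K] {p : ℕ} [hp : Fact p.Prime]

open Literature.Geometry.Kaehler.FiniteAddGroup in
/-- For a class-group component `C = e_ψ(ℤ_p ⊗ Cl(𝓞 K))` (a finite `ℤ_p`-module): `#C[p] = 1 ↔ #C = 1` (`classGroupChiCard = 1`) — a
non-zero element of a finite `p`-group module has a non-zero multiple killed by `p`. [cite: Washington1997, §6.3] -/
theorem natCard_torsion_classGroupChiComponent_eq_one_iff (ψ : (K ≃ₐ[ℚ] K) → ℤ_[p]) :
    Nat.card {y : ↥(classGroupChiComponent ℚ K p ψ) // p • y = 0} = 1 ↔ classGroupChiCard ℚ K p ψ = 1 := by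
  set N := Additive (ClassGroup (𝓞 K)) with hN
  set C := classGroupChiComponent ℚ K p ψ with hC
  have h0mem : p • (0 : ↥C) = 0 := smul_zero _
  constructor
  · intro h
    by_contra hne
    have hne' : Nat.card ↥C ≠ 1 := hne
    have h1 : 1 < Nat.card ↥C := by
      have hpos : 0 < Nat.card ↥C := Nat.card_pos
      omega
    haveI : Nontrivial ↥C := Finite.one_lt_card_iff_nontrivial.mp h1
    obtain ⟨y, hy⟩ := exists_ne (0 : ↥C)
    have hy0 : (y : ℤ_[p] ⊗[ℤ] N) ≠ 0 := fun h0 => hy (Subtype.ext h0)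
    obtain ⟨y', hy'C, hy'0, hpy'⟩ :=
      KummerRadical.exists_mem_ne_zero_prime_smul_eq_zero (natCard_padicIntTensor N p) C y.2 hy0
    have hpy'' : p • (⟨y', hy'C⟩ : ↥C) = 0 := by
      apply Subtype.ext
      rw [Submodule.coe_smul_of_tower, Submodule.coe_zero, ← Nat.cast_smul_eq_nsmul ℤ_[p], hpy']
    have hne' : (⟨⟨y', hy'C⟩, hpy''⟩ : {y : ↥C // p • y = 0}) ≠ ⟨0, h0mem⟩ := fun h2 => by
      have h3 := congrArg (fun z : {y : ↥C // p • y = 0} => ((z.1 : ↥C) : ℤ_[p] ⊗[ℤ] N)) h2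
      exact hy'0 h3
    haveI : Nontrivial {y : ↥C // p • y = 0} := ⟨⟨_, _, hne'⟩⟩
    have h2 : 1 < Nat.card {y : ↥C // p • y = 0} := Finite.one_lt_card_iff_nontrivial.mpr inferInstance
    omega
  · intro h
    obtain ⟨hsub, -⟩ := Nat.card_eq_one_iff_unique.mp h
    haveI := hsub
    exact Nat.card_eq_one_iff_unique.mpr ⟨⟨fun a b => Subtype.ext (Subsingleton.elim _ _)⟩, ⟨⟨0, h0mem⟩⟩⟩

open Literature.Geometry.Kaehler.FiniteAddGroup in
/-- … and `#C[p] ≠ 1 ↔ p ≤ #C[p]` (the `p`-torsion has `p`-power order). [cite: Washington1997, §6.3] -/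
theorem prime_le_natCard_torsion_classGroupChiComponent_iff (ψ : (K ≃ₐ[ℚ] K) → ℤ_[p]) :
    p ≤ Nat.card {y : ↥(classGroupChiComponent ℚ K p ψ) // p • y = 0} ↔
      Nat.card {y : ↥(classGroupChiComponent ℚ K p ψ) // p • y = 0} ≠ 1 := by
  obtain ⟨s, hs⟩ := KummerRadical.exists_natCard_torsion_classGroupChiComponent_eq_pow (K := K) ψ
  rw [hs]
  constructor
  · intro h h1
    rw [h1] at h
    exact absurd h (not_le.mpr hp.out.one_lt)
  · intro h
    have hs0 : s ≠ 0 := fun h0 => h (by rw [h0, pow_zero])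
    calc p = p ^ 1 := (pow_one p).symm
      _ ≤ p ^ s := Nat.pow_le_pow_right hp.out.pos (Nat.one_le_iff_ne_zero.mpr hs0)

end Currency

section EqualityCurrency

variable {p : ℕ} [hp : Fact p.Prime]
variable {A : Type} [AddCommGroup A] [DistribMulAction (absoluteGaloisGroup ℚ) A] [TopologicalSpace A] [DiscreteTopology A]

/-- **EVEN-REGULAR ⟺ `#R_rel(χ̄) = p`; EVEN-IRREGULAR ⟺ `#R_rel(χ̄) ≥ p²`** — the equality of §2 read in the `classGroupChiCard` currency of
w2 g11's p685598 §3 / w4 g10's p683684: under the hypotheses of `natCard_h1Unramified_eq_prime_mul_natCard_torsion_of_odd_character`,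
`#h1Unramified A S_p = p ↔ classGroupChiCard ℚ K' p (ω∘ψ̄) = 1` and `p² ≤ #h1Unramified A S_p ↔ classGroupChiCard ℚ K' p (ω∘ψ̄) ≠ 1`.
So on CASE R members the B1-sha dichotomy of the first-order census is an `iff` in the size of ONE relaxed residual group.
[cite: Washington1997, §10.2 (Thm. 10.9)] [cite: Gras2003, Ch. II §5.4] -/
theorem natCard_h1Unramified_eq_prime_iff_and_sq_le_iff_of_odd_character
    (hcard : Nat.card A = p)
    (hcont : ∀ a : A, Continuous fun g : absoluteGaloisGroup ℚ ↦ g • a)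
    (hnt : ∃ (g : absoluteGaloisGroup ℚ) (a : A), g • a ≠ a)
    (θ : absoluteGaloisGroup ℚ →* (ZMod p)ˣ)
    (hθ : ∀ (g : absoluteGaloisGroup ℚ) (a : A), g • a = (((θ g : ZMod p).val : ℕ) : ℤ) • a)
    (hker : ∀ g : absoluteGaloisGroup ℚ, θ g = 1 ↔ ∀ a : A, g • a = a)
    {c : absoluteGaloisGroup ℚ} (hθc : θ c = -1)
    (H : ∀ (ℓ : HeightOneSpectrum (𝓞 ℚ)), ((p : ℕ) : 𝓞 ℚ) ∈ ℓ.asIdeal → ∀ 𝔓 ∈ ℓ.primesAbove,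
      ∃ g ∈ 𝔓.decompositionSubgroup (absoluteGaloisGroup ℚ), θ g ≠ modNCyclotomicCharacter ℚ p g)
    (hrad : ∃ g : absoluteGaloisGroup ℚ, θ g ≠ modNCyclotomicCharacter ℚ p g)
    {K' : Type} [Field K'] [NumberField K'] [IsCMField K'] [IsAbelianGalois ℚ K'] {ζ : K'} (hζ : IsPrimitiveRoot ζ p)
    (hpK : ¬ p ∣ Module.finrank ℚ K')
    (hrK : ∀ σ : absoluteGaloisGroup K', θ (absGaloisRestrict ℚ K' σ) = 1)
    (hk : ∃ k : ℕ, ¬ p ∣ k ∧ ∀ n : absoluteGaloisGroup ℚ, θ n = 1 → n ^ k ∈ (absGaloisRestrict ℚ K').range)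
    (hcc : absGaloisQuot ℚ K' c = (IsCMField.complexConj K').restrictScalars ℚ)
    (χb ψb : (K' ≃ₐ[ℚ] K') →* (ZMod p)ˣ) (hχb : ∀ γ : absoluteGaloisGroup ℚ, χb (absGaloisQuot ℚ K' γ) = θ γ)
    (hψb : ∀ γ : absoluteGaloisGroup ℚ, ψb (absGaloisQuot ℚ K' γ) = modNCyclotomicCharacter ℚ p γ * (θ γ)⁻¹) :
    (Nat.card ↥(h1Unramified A {v' : HeightOneSpectrum (𝓞 ℚ) | ((p : ℕ) : 𝓞 ℚ) ∈ v'.asIdeal}) = p ↔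
        classGroupChiCard ℚ K' p (fun g => (((teichmullerChar p).comp ψb g : ℤ_[p]ˣ) : ℤ_[p])) = 1) ∧
      (p ^ 2 ≤ Nat.card ↥(h1Unramified A {v' : HeightOneSpectrum (𝓞 ℚ) | ((p : ℕ) : 𝓞 ℚ) ∈ v'.asIdeal}) ↔
        classGroupChiCard ℚ K' p (fun g => (((teichmullerChar p).comp ψb g : ℤ_[p]ˣ) : ℤ_[p])) ≠ 1) := by
  have hpr : p.Prime := hp.out
  have heq := natCard_h1Unramified_eq_prime_mul_natCard_torsion_of_odd_character hcard hcont hnt θ hθ hker hθc H hrad hζ hpK hrK hk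
    hcc χb ψb hχb hψb
  have hiff := natCard_torsion_classGroupChiComponent_eq_one_iff (K := K')
    (fun g => (((teichmullerChar p).comp ψb g : ℤ_[p]ˣ) : ℤ_[p]))
  have hle := prime_le_natCard_torsion_classGroupChiComponent_iff (K := K')
    (fun g => (((teichmullerChar p).comp ψb g : ℤ_[p]ˣ) : ℤ_[p]))
  rw [heq, pow_two]
  constructor
  · rw [mul_eq_left₀ hpr.ne_zero]
    exact hiff
  · constructor
    · intro h h1
      exact (hle.mp (Nat.le_of_mul_le_mul_left h hpr.pos)) (hiff.mpr h1)
    · intro h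
      exact Nat.mul_le_mul_left p (hle.mpr fun h1 => h (hiff.mp h1))

end EqualityCurrency

end Summit.BirchSwinnertonDyer.BirchSwinnertonDyer.Theorems.PrintCFram.SelmerCount

end
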